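import Literature.Geometry.Symplectic.SteinPALF
import Literature.Topology.FourManifolds.LefschetzChartMorseIndex
import Literature.Topology.FourManifolds.SPC4HandleChainProofs
import Mathlib.Analysis.InnerProductSpace.Calculus
import HarnessLib

/-!
# Height functions on a PALF are Morse, with critical points exactly the Lefschetz points, all
# of index `2`

Topic `Literature/Geometry/Symplectic`; theorems-only companion of the PALF vocabulary
`SteinPALF.lean` (`Literature.Geometry.Symplectic.PALF o b`: a positive allowable Lefschetz
fibration of a 4-manifold with boundary `W`, model `𝓡∂ 4`, onto the closed unit disc
`𝔻² ⊂ ℝ²`, with its finite critical set `crit` of positive Lefschetz points, a submersion off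
`crit`).  It records the local half of **Kas' handlebody of a Lefschetz fibration** in the tree's
Morse currency (`Literature.Topology.FourManifolds.IsMorse`, `criticalSetOfIndex`, `morseIndex`):
Kas 1980, Lemma 1.6 and Thm. 1.7 / Gompf–Stipsicz 1999, §8.2 — *passing a singular fibre attaches
exactly one `2`-handle* — i.e. (Milnor 1963, §2–§3) a Lefschetz critical point is a nondegenerate
critical point of INDEX `2` of any function `ℓ ∘ f` pulled back from the base with `dℓ ≠ 0` at
the critical value, and a regular point of `f` is a regular point of `ℓ ∘ f`.  The chart-level
index computation is the tree's `LefschetzChart.morseIndex_comp`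
(`Literature/Topology/FourManifolds/LefschetzChartMorseIndex.lean`, any model on `ℝ⁴`, here
`𝓡∂ 4`); this file assembles it over `PALF`:

* `PALF.isInteriorPoint_of_mem_crit`, `PALF.crit_subset_interior` — the Lefschetz points are
  interior points of `W`;
* `PALF.isMCriticalPt_nondegenerate_morseIndex_comp` — at `p ∈ crit`, for `ℓ : ℝ² → ℝ` smooth at
  `f p` with `dℓ_{f p} ≠ 0`, `ℓ ∘ f` has a nondegenerate critical point of Morse index `2`;
* `PALF.not_isMCriticalPt_comp` — off `crit` (boundary points included), `ℓ ∘ f` is not critical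
  where `dℓ_{f x} ≠ 0`;
* `PALF.criticalSet_comp_eq`, `PALF.isMorse_comp`, `PALF.criticalSetOfIndex_comp_two`,
  `PALF.criticalSetOfIndex_comp_of_ne_two`, `PALF.ncard_criticalSetOfIndex_comp` — for `ℓ` smooth
  with `dℓ ≠ 0` on the closed unit disc: **`ℓ ∘ f` is a Morse function on `W` whose critical set
  is exactly `crit`, every critical point of index `2`**, so that it has `#crit` critical points of
  index `2` and none of any other index;
* the two standard choices of `ℓ`: a nonzero linear form (`PALF.isMorse_linear_comp`, the height
  functions `⟨f, v⟩`) and the squared distance `z ↦ ‖z - c‖²` to a point `c` outside the closed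
  disc (`PALF.isMorse_normSq_sub_comp`, whose sublevel sets are the preimages of the round discs
  about `c` sweeping `𝔻²` — the discs of Kas' inductive handle attachment).

* `PALF.norm_apply_lt_one_of_mem_crit`, `PALF.norm_lt_one_of_mem_image_crit`,
  `PALF.isBoundaryPoint_of_norm_apply_eq_one`, `PALF.norm_apply_lt_one_of_isInteriorPoint` — two
  consequences which `SteinPALF.lean` deliberately left unrecorded (*"No smallness of critical
  values (`‖f p‖ < 1`) or verticality clause (`‖f x‖ = 1 ⇒ x ∈ ∂W` off `crit`) is recorded: both
  follow"*), now DERIVED: **the critical values lie in the open disc** (a Lefschetz point is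
  never a local maximum of `‖f‖²`, `LefschetzChart.not_isLocalMax_comp`) and **the vertical
  boundary `{‖f‖ = 1}` consists of boundary points** (Fermat at interior points,
  `isMCriticalPt_of_isLocalMax`, against `PALF.not_isMCriticalPt_comp`).

Such an `ℓ ∘ f` is NOT adapted to `∂W` (it is not constant on the boundary); the boundary
normal form (`IsMorseAdapted`) belongs to the global half of Kas' theorem (Ehresmann with boundary
and the fibre's own Morse function), which is not addressed here.  No definitions, no named facts.

## References

* A. Kas, *On the handlebody decomposition associated to a Lefschetz fibration*, Pacific J. Math.
  89 (1980), 89–104, Lemma 1.6, Thm. 1.7. [Kas1980]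
* R. E. Gompf, A. I. Stipsicz, *4-Manifolds and Kirby Calculus*, GSM 20 (1999), §8.2.
  [GompfStipsiczGSM1999]
* J. Milnor, *Morse theory*, Ann. of Math. Studies 51 (1963), §2–§3. [Milnor1963]
* S. Akbulut, B. Ozbagci, *Lefschetz fibrations on compact Stein surfaces*, Geom. Topol. 5 (2001),
  §2.3. [AkbulutOzbagci2001]
* C. Wendl, *Holomorphic Curves in Low Dimensions*, LNM 2216 (2018), Def. 9.33. [Wendl2018]
-/

noncomputable section

open scoped Manifold ContDiff Topology
open Set Function

namespace Literature.Geometry.Symplectic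

open Literature.Topology.FourManifolds

universe u

variable {W : Type u} [TopologicalSpace W] [ChartedSpace (EuclideanHalfSpace 4) W]
  [IsManifold (𝓡∂ 4) ∞ W]
  {o : SmoothOrientation (𝓡∂ 4) W} {b : BoundaryData (𝓡∂ 4) W (𝓡 3)} (P : PALF o b)

namespace PALF

/-! ### At the Lefschetz points -/

/-- **The critical points of a PALF are interior points** of the total space (a point with a
Lefschetz chart is interior, `LefschetzChart.isInteriorPoint`). [folklore] -/
theorem isInteriorPoint_of_mem_crit {p : W} (hp : p ∈ P.crit) : (𝓡∂ 4).IsInteriorPoint p :=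
  (P.lefschetz p hp).isInteriorPoint

/-- The critical set of a PALF lies in the interior of `W`. [folklore] -/
theorem crit_subset_interior : (↑P.crit : Set W) ⊆ (𝓡∂ 4).interior W :=
  fun _ hp => P.isInteriorPoint_of_mem_crit hp

/-- **A Lefschetz point of a PALF is a nondegenerate critical point of index `2` of `ℓ ∘ f`**
for every `ℓ : ℝ² → ℝ` smooth at the critical value with `dℓ_{f p} ≠ 0` (Milnor 1963, §2 in a
Lefschetz chart; Kas 1980, Lemma 1.6: the singular fibre contributes one `2`-handle).
[cite: Kas1980, Lemma 1.6] [cite: Milnor1963, §2] -/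
theorem isMCriticalPt_nondegenerate_morseIndex_comp {p : W} (hp : p ∈ P.crit)
    {ℓ : EuclideanSpace ℝ (Fin 2) → ℝ}
    (hℓ : ContMDiffAt 𝓘(ℝ, EuclideanSpace ℝ (Fin 2)) 𝓘(ℝ, ℝ) ∞ ℓ (P.f p))
    (hℓp : mfderiv 𝓘(ℝ, EuclideanSpace ℝ (Fin 2)) 𝓘(ℝ, ℝ) ℓ (P.f p) ≠ 0) :
    IsMCriticalPt (𝓡∂ 4) (ℓ ∘ P.f) p ∧ (mhessian (𝓡∂ 4) (ℓ ∘ P.f) p).Nondegenerate ∧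
      morseIndex (𝓡∂ 4) (ℓ ∘ P.f) p = 2 :=
  (P.lefschetz p hp).isMCriticalPt_nondegenerate_morseIndex_comp hℓ hℓp

/-! ### Off the Lefschetz points -/

/-- **A regular point of `f` is a regular point of `ℓ ∘ f`** wherever `dℓ_{f x} ≠ 0` (boundary
points included: `f` is a submersion at every point off `crit`; chain rule, Milnor 1963, §2).
[cite: Milnor1963, §2] -/
theorem not_isMCriticalPt_comp {x : W} (hx : x ∉ P.crit) {ℓ : EuclideanSpace ℝ (Fin 2) → ℝ}
    (hℓ : MDifferentiableAt 𝓘(ℝ, EuclideanSpace ℝ (Fin 2)) 𝓘(ℝ, ℝ) ℓ (P.f x))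
    (hℓx : mfderiv 𝓘(ℝ, EuclideanSpace ℝ (Fin 2)) 𝓘(ℝ, ℝ) ℓ (P.f x) ≠ 0) :
    ¬ IsMCriticalPt (𝓡∂ 4) (ℓ ∘ P.f) x :=
  not_isMCriticalPt_comp_of_surjective_mfderiv ((P.contMDiff x).mdifferentiableAt (by simp)) hℓ
    (P.submersion x hx) hℓx

/-! ### Functions pulled back from the base with `dℓ ≠ 0` on the closed disc -/

section Global

variable {ℓ : EuclideanSpace ℝ (Fin 2) → ℝ}

/-- **The critical set of `ℓ ∘ f` is exactly the critical set of the PALF** when `ℓ` is smooth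
with `dℓ ≠ 0` on the closed unit disc (the range of `f`). [cite: Kas1980, Lemma 1.6]
[cite: Milnor1963, §2] -/
theorem criticalSet_comp_eq (hℓ : ContMDiff 𝓘(ℝ, EuclideanSpace ℝ (Fin 2)) 𝓘(ℝ, ℝ) ∞ ℓ)
    (hℓ' : ∀ z : EuclideanSpace ℝ (Fin 2), ‖z‖ ≤ 1 →
      mfderiv 𝓘(ℝ, EuclideanSpace ℝ (Fin 2)) 𝓘(ℝ, ℝ) ℓ z ≠ 0) :
    criticalSet (𝓡∂ 4) (ℓ ∘ P.f) = ↑P.crit := by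
  ext x
  rw [mem_criticalSet, Finset.mem_coe]
  refine ⟨fun hx => ?_, fun hx => ?_⟩
  · by_contra hx'
    exact P.not_isMCriticalPt_comp hx' ((hℓ _).mdifferentiableAt (by simp))
      (hℓ' _ (P.norm_apply_le_one x)) hx
  · exact (P.isMCriticalPt_nondegenerate_morseIndex_comp hx (hℓ _)
      (hℓ' _ (P.norm_apply_le_one x))).1

/-- **`ℓ ∘ f` is a Morse function on `W`** (smooth, every critical point nondegenerate) when `ℓ`
is smooth with `dℓ ≠ 0` on the closed unit disc. [cite: Kas1980, Lemma 1.6] [cite: Milnor1963, §2] -/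
theorem isMorse_comp (hℓ : ContMDiff 𝓘(ℝ, EuclideanSpace ℝ (Fin 2)) 𝓘(ℝ, ℝ) ∞ ℓ)
    (hℓ' : ∀ z : EuclideanSpace ℝ (Fin 2), ‖z‖ ≤ 1 →
      mfderiv 𝓘(ℝ, EuclideanSpace ℝ (Fin 2)) 𝓘(ℝ, ℝ) ℓ z ≠ 0) :
    IsMorse (𝓡∂ 4) (ℓ ∘ P.f) := by
  refine ⟨hℓ.comp P.contMDiff, fun x hx => ?_⟩
  have hx' : x ∈ (↑P.crit : Set W) := by rw [← P.criticalSet_comp_eq hℓ hℓ']; exact hx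
  exact (P.isMCriticalPt_nondegenerate_morseIndex_comp (Finset.mem_coe.1 hx') (hℓ _)
    (hℓ' _ (P.norm_apply_le_one x))).2.1

/-- **Every critical point of `ℓ ∘ f` has index `2`**: the critical points of index `2` are
exactly the Lefschetz points. [cite: Kas1980, Lemma 1.6] [cite: Milnor1963, §2] -/
theorem criticalSetOfIndex_comp_two (hℓ : ContMDiff 𝓘(ℝ, EuclideanSpace ℝ (Fin 2)) 𝓘(ℝ, ℝ) ∞ ℓ)
    (hℓ' : ∀ z : EuclideanSpace ℝ (Fin 2), ‖z‖ ≤ 1 →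
      mfderiv 𝓘(ℝ, EuclideanSpace ℝ (Fin 2)) 𝓘(ℝ, ℝ) ℓ z ≠ 0) :
    criticalSetOfIndex (𝓡∂ 4) (ℓ ∘ P.f) 2 = ↑P.crit := by
  ext x
  rw [mem_criticalSetOfIndex, Finset.mem_coe]
  refine ⟨fun hx => ?_, fun hx => ?_⟩
  · have h : x ∈ criticalSet (𝓡∂ 4) (ℓ ∘ P.f) := hx.1
    rw [P.criticalSet_comp_eq hℓ hℓ'] at h
    exact Finset.mem_coe.1 h
  · have h := P.isMCriticalPt_nondegenerate_morseIndex_comp hx (hℓ _)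
      (hℓ' _ (P.norm_apply_le_one x))
    exact ⟨h.1, h.2.2⟩

/-- … and there are no critical points of any other index. [cite: Kas1980, Lemma 1.6]
[cite: Milnor1963, §2] -/
theorem criticalSetOfIndex_comp_of_ne_two (hℓ : ContMDiff 𝓘(ℝ, EuclideanSpace ℝ (Fin 2)) 𝓘(ℝ, ℝ) ∞ ℓ)
    (hℓ' : ∀ z : EuclideanSpace ℝ (Fin 2), ‖z‖ ≤ 1 →
      mfderiv 𝓘(ℝ, EuclideanSpace ℝ (Fin 2)) 𝓘(ℝ, ℝ) ℓ z ≠ 0) {k : ℕ} (hk : k ≠ 2) :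
    criticalSetOfIndex (𝓡∂ 4) (ℓ ∘ P.f) k = ∅ := by
  ext x
  simp only [mem_criticalSetOfIndex, mem_empty_iff_false, iff_false, not_and]
  intro hx
  have h : x ∈ criticalSet (𝓡∂ 4) (ℓ ∘ P.f) := hx
  rw [P.criticalSet_comp_eq hℓ hℓ'] at h
  rw [(P.isMCriticalPt_nondegenerate_morseIndex_comp (Finset.mem_coe.1 h) (hℓ _)
    (hℓ' _ (P.norm_apply_le_one x))).2.2]
  exact fun h2 => hk h2.symm

/-- **The Morse count of `ℓ ∘ f`**: `#crit` critical points of index `2`, none of any other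
index (Kas 1980, Thm. 1.7 / Gompf–Stipsicz 1999, §8.2: one `2`-handle per singular fibre, on
top of the handles of `F × D²`). [cite: Kas1980, Thm. 1.7] [cite: GompfStipsiczGSM1999, §8.2] -/
theorem ncard_criticalSetOfIndex_comp (hℓ : ContMDiff 𝓘(ℝ, EuclideanSpace ℝ (Fin 2)) 𝓘(ℝ, ℝ) ∞ ℓ)
    (hℓ' : ∀ z : EuclideanSpace ℝ (Fin 2), ‖z‖ ≤ 1 →
      mfderiv 𝓘(ℝ, EuclideanSpace ℝ (Fin 2)) 𝓘(ℝ, ℝ) ℓ z ≠ 0) (k : ℕ) :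
    (criticalSetOfIndex (𝓡∂ 4) (ℓ ∘ P.f) k).ncard = if k = 2 then P.crit.card else 0 := by
  split_ifs with hk
  · rw [hk, P.criticalSetOfIndex_comp_two hℓ hℓ', ncard_coe_finset]
  · rw [P.criticalSetOfIndex_comp_of_ne_two hℓ hℓ' hk, ncard_empty]

end Global

/-! ### The two standard choices of `ℓ` -/

/-- The derivative of a nonzero linear form `Λ` on `ℝ²` is `Λ ≠ 0` everywhere. [folklore] -/
theorem mfderiv_linear_ne_zero {Λ : EuclideanSpace ℝ (Fin 2) →L[ℝ] ℝ} (hΛ : Λ ≠ 0)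
    (z : EuclideanSpace ℝ (Fin 2)) :
    mfderiv 𝓘(ℝ, EuclideanSpace ℝ (Fin 2)) 𝓘(ℝ, ℝ) Λ z ≠ 0 := by
  rw [mfderiv_eq_fderiv, Λ.fderiv]; exact hΛ

/-- **Height functions on a PALF are Morse with critical set `crit`, all of index `2`**: for a
nonzero linear form `Λ` on `ℝ²` (e.g. `z ↦ ⟨z, v⟩`, `v ≠ 0`), `Λ ∘ f` is Morse, its critical
set is `crit`, its index-`2` critical set is `crit` and it has no critical points of other
indices. [cite: Kas1980, Lemma 1.6 and Thm. 1.7] [cite: Milnor1963, §2] -/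
theorem isMorse_linear_comp {Λ : EuclideanSpace ℝ (Fin 2) →L[ℝ] ℝ} (hΛ : Λ ≠ 0) :
    IsMorse (𝓡∂ 4) (Λ ∘ P.f) ∧ criticalSet (𝓡∂ 4) (Λ ∘ P.f) = ↑P.crit ∧
      criticalSetOfIndex (𝓡∂ 4) (Λ ∘ P.f) 2 = ↑P.crit ∧
      ∀ k, k ≠ 2 → criticalSetOfIndex (𝓡∂ 4) (Λ ∘ P.f) k = ∅ :=
  ⟨P.isMorse_comp Λ.contMDiff fun z _ => mfderiv_linear_ne_zero hΛ z,
    P.criticalSet_comp_eq Λ.contMDiff fun z _ => mfderiv_linear_ne_zero hΛ z,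
    P.criticalSetOfIndex_comp_two Λ.contMDiff fun z _ => mfderiv_linear_ne_zero hΛ z,
    fun _ hk => P.criticalSetOfIndex_comp_of_ne_two Λ.contMDiff
      (fun z _ => mfderiv_linear_ne_zero hΛ z) hk⟩

/-- The squared distance `z ↦ ‖z - c‖²` to a point is smooth. [folklore] -/
theorem contMDiff_normSq_sub (c : EuclideanSpace ℝ (Fin 2)) :
    ContMDiff 𝓘(ℝ, EuclideanSpace ℝ (Fin 2)) 𝓘(ℝ, ℝ) ∞
      (fun z : EuclideanSpace ℝ (Fin 2) => ‖z - c‖ ^ 2) :=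
  contMDiff_iff_contDiff.2 ((contDiff_norm_sq ℝ).comp (contDiff_id.sub contDiff_const))

/-- The squared distance `z ↦ ‖z - c‖²` has nonvanishing derivative `2 ⟨z - c, ·⟩` at every
`z ≠ c`. [folklore] -/
theorem mfderiv_normSq_sub_ne_zero_of_ne {c z : EuclideanSpace ℝ (Fin 2)} (hne : z ≠ c) :
    mfderiv 𝓘(ℝ, EuclideanSpace ℝ (Fin 2)) 𝓘(ℝ, ℝ)
      (fun z : EuclideanSpace ℝ (Fin 2) => ‖z - c‖ ^ 2) z ≠ 0 := by
  have hzc : z - c ≠ 0 := sub_ne_zero.2 hne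
  have hd : HasFDerivAt (fun z : EuclideanSpace ℝ (Fin 2) => ‖z - c‖ ^ 2)
      ((2 : ℕ) • (innerSL ℝ (z - c)).comp (ContinuousLinearMap.id ℝ _)) z :=
    ((hasFDerivAt_id z).sub_const c).norm_sq
  rw [mfderiv_eq_fderiv, hd.fderiv]
  intro h0
  have h1 : (2 : ℕ) • ((innerSL ℝ (z - c)) (z - c)) = 0 := by
    have h := DFunLike.congr_fun h0 (z - c)
    change (2 : ℕ) • ((innerSL ℝ (z - c)) (ContinuousLinearMap.id ℝ _ (z - c))) = (0 : ℝ) at h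
    rwa [ContinuousLinearMap.id_apply] at h
  rw [innerSL_apply_apply, real_inner_self_eq_norm_sq] at h1
  rcases smul_eq_zero.1 h1 with h | h
  · exact absurd h two_ne_zero
  · exact hzc (norm_eq_zero.1 ((pow_eq_zero_iff two_ne_zero).1 h))

/-- In particular, for `c` outside the closed unit disc the derivative of `z ↦ ‖z - c‖²` vanishes
nowhere on the disc. [folklore] -/
theorem mfderiv_normSq_sub_ne_zero {c : EuclideanSpace ℝ (Fin 2)} (hc : 1 < ‖c‖)
    (z : EuclideanSpace ℝ (Fin 2)) (hz : ‖z‖ ≤ 1) :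
    mfderiv 𝓘(ℝ, EuclideanSpace ℝ (Fin 2)) 𝓘(ℝ, ℝ)
      (fun z : EuclideanSpace ℝ (Fin 2) => ‖z - c‖ ^ 2) z ≠ 0 :=
  mfderiv_normSq_sub_ne_zero_of_ne fun h => by
    rw [h] at hz
    exact absurd (lt_of_lt_of_le hc hz) (lt_irrefl _)

/-- **The squared distance to a point outside the disc, pulled back to a PALF, is Morse with
critical set `crit`, all of index `2`**: for `‖c‖ > 1`, `x ↦ ‖f x - c‖²` is a Morse function on
`W` whose critical set and index-`2` critical set are `crit`, with no critical points of other
indices.  Its sublevel sets `{‖f - c‖² ≤ r²}` are the preimages `f⁻¹(𝔻² ∩ B̄(c, r))` of the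
round discs about `c` sweeping the unit disc — the growing family of discs of Kas' inductive
attachment of one `2`-handle per singular fibre (Kas 1980, Thm. 1.7; Gompf–Stipsicz 1999,
§8.2). [cite: Kas1980, Lemma 1.6 and Thm. 1.7] [cite: GompfStipsiczGSM1999, §8.2] -/
theorem isMorse_normSq_sub_comp {c : EuclideanSpace ℝ (Fin 2)} (hc : 1 < ‖c‖) :
    IsMorse (𝓡∂ 4) ((fun z : EuclideanSpace ℝ (Fin 2) => ‖z - c‖ ^ 2) ∘ P.f) ∧
      criticalSet (𝓡∂ 4) ((fun z : EuclideanSpace ℝ (Fin 2) => ‖z - c‖ ^ 2) ∘ P.f) = ↑P.crit ∧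
      criticalSetOfIndex (𝓡∂ 4) ((fun z : EuclideanSpace ℝ (Fin 2) => ‖z - c‖ ^ 2) ∘ P.f) 2 =
        ↑P.crit ∧
      ∀ k, k ≠ 2 →
        criticalSetOfIndex (𝓡∂ 4) ((fun z : EuclideanSpace ℝ (Fin 2) => ‖z - c‖ ^ 2) ∘ P.f) k =
          ∅ :=
  ⟨P.isMorse_comp (contMDiff_normSq_sub c) (mfderiv_normSq_sub_ne_zero hc),
    P.criticalSet_comp_eq (contMDiff_normSq_sub c) (mfderiv_normSq_sub_ne_zero hc),
    P.criticalSetOfIndex_comp_two (contMDiff_normSq_sub c) (mfderiv_normSq_sub_ne_zero hc),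
    fun _ hk => P.criticalSetOfIndex_comp_of_ne_two (contMDiff_normSq_sub c)
      (mfderiv_normSq_sub_ne_zero hc) hk⟩


/-! ### Critical values lie in the open disc; the vertical boundary is boundary -/

/-- If `‖f x‖ = 1` then `x` is a global — in particular a local — maximum of `‖f‖² = ‖f - 0‖²`
(`‖f‖ ≤ 1` everywhere, `PALF.norm_apply_le_one`). [folklore] -/
theorem isLocalMax_normSq_comp_of_norm_apply_eq_one {x : W} (h1 : ‖P.f x‖ = 1) :
    IsLocalMax ((fun z : EuclideanSpace ℝ (Fin 2) => ‖z - 0‖ ^ 2) ∘ P.f) x := by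
  refine Filter.Eventually.of_forall fun y => ?_
  show ‖P.f y - 0‖ ^ 2 ≤ ‖P.f x - 0‖ ^ 2
  rw [sub_zero, sub_zero, h1]
  have hy := P.norm_apply_le_one y
  have h0 := norm_nonneg (P.f y)
  nlinarith

/-- **The critical values of a PALF lie in the OPEN unit disc**: `‖f p‖ < 1` for `p ∈ crit`
(Akbulut–Ozbagci 2001, §2.3 / Wendl 2018, Def. 9.33: *"finitely many interior critical points
and interior critical values"*; here DERIVED from the structure: were `‖f p‖ = 1`, the
Lefschetz point `p` would be a local maximum of `‖f‖²`, a function pulled back from the base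
with nonzero differential at `f p ≠ 0` — impossible, its Hessian at `p` takes both signs,
`LefschetzChart.not_isLocalMax_comp`). [cite: AkbulutOzbagci2001, §2.3] -/
theorem norm_apply_lt_one_of_mem_crit {p : W} (hp : p ∈ P.crit) : ‖P.f p‖ < 1 := by
  refine lt_of_le_of_ne (P.norm_apply_le_one p) fun h1 => ?_
  have hp0 : P.f p ≠ 0 := by
    intro h0
    rw [h0, norm_zero] at h1
    exact zero_ne_one h1
  exact ((P.lefschetz p hp).not_isLocalMax_not_isLocalMin_comp (contMDiff_normSq_sub 0 _)
    (mfderiv_normSq_sub_ne_zero_of_ne hp0)).1 (P.isLocalMax_normSq_comp_of_norm_apply_eq_one h1)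

/-- The critical VALUES of a PALF lie in the open unit disc. [cite: AkbulutOzbagci2001, §2.3] -/
theorem norm_lt_one_of_mem_image_crit {v : EuclideanSpace ℝ (Fin 2)} (hv : v ∈ P.f '' ↑P.crit) :
    ‖v‖ < 1 := by
  obtain ⟨p, hp, rfl⟩ := hv
  exact P.norm_apply_lt_one_of_mem_crit (Finset.mem_coe.1 hp)

/-- **The vertical boundary is boundary**: a point `x` with `‖f x‖ = 1` is a boundary point of
`W` (Wendl 2018, Def. 9.33 (1): `Π⁻¹(∂𝔻²) = ∂_v W ⊆ ∂W`; here DERIVED: `x ∉ crit` by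
`norm_apply_lt_one_of_mem_crit`, so `f` is a submersion at `x`; were `x` interior it would be
an interior local maximum of `‖f‖²`, hence a critical point of it by Fermat
(`isMCriticalPt_of_isLocalMax`), contradicting `PALF.not_isMCriticalPt_comp`).
[cite: Wendl2018, Def. 9.33] -/
theorem isBoundaryPoint_of_norm_apply_eq_one {x : W} (h1 : ‖P.f x‖ = 1) :
    (𝓡∂ 4).IsBoundaryPoint x := by
  rw [(𝓡∂ 4).isBoundaryPoint_iff_not_isInteriorPoint]
  intro hint
  have hx : x ∉ P.crit := fun hx => by
    have h := P.norm_apply_lt_one_of_mem_crit hx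
    rw [h1] at h
    exact lt_irrefl _ h
  have hx0 : P.f x ≠ 0 := by
    intro h0
    rw [h0, norm_zero] at h1
    exact zero_ne_one h1
  exact P.not_isMCriticalPt_comp hx ((contMDiff_normSq_sub 0 _).mdifferentiableAt (by simp))
    (mfderiv_normSq_sub_ne_zero_of_ne hx0)
    (isMCriticalPt_of_isLocalMax (P.isLocalMax_normSq_comp_of_norm_apply_eq_one h1) hint)

/-- Equivalently: **interior points of `W` map into the open unit disc.** [cite: Wendl2018, Def. 9.33] -/
theorem norm_apply_lt_one_of_isInteriorPoint {x : W} (hx : (𝓡∂ 4).IsInteriorPoint x) :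
    ‖P.f x‖ < 1 := by
  refine lt_of_le_of_ne (P.norm_apply_le_one x) fun h1 => ?_
  exact ((𝓡∂ 4).isBoundaryPoint_iff_not_isInteriorPoint x).1
    (P.isBoundaryPoint_of_norm_apply_eq_one h1) hx

end PALF

end Literature.Geometry.Symplectic

end
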